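import Summits.Parity.GeneralizedHardyLittlewood.Theorems.LeeYangFibresCellParityLawKernelDefs
import Literature.NumberTheory.Sieve.LinearEquationsInPrimesDimOne
import Literature.NumberTheory.Sieve.SieveFramework
import HarnessLib

/-!
# Route `LeeYangFibres`, crux `CellParityLaw` (stmt-Parity-14109), line `section-annihilator`:
# the weight-side identities `SectionSeqBCells` of the section sequence `secSeqB` (skeleton v13)

Proof of the registered stub `stub_sectionSeqBCells : SectionSeqBCells` (elementary counting on the
one-dimensional lattice, no analytic input). For a system `Ψ` of `t + 1` forms on `ℤ¹`, a body `K`, a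
scale `N`, a roughness `u`, a coordinate `i` and frozen cells `j'`, the weights of `secSeqB Ψ K N u i j'` are
the section weights `b(q) = #{n ∈ [-N,N] ∩ K : ψ_i(n) = q, ψ_{i.succAbove k}(n) ∈ cell j'_k ∀ k}`, and:

* (a) `b(q) ≤ 1` when `a_i ≠ 0` (`n ↦ ψ_i(n) = a_i n + b_i` is injective on `ℤ¹`);
* (b) `b(q) = 0` for `q > x` once `x` bounds the values of `ψ_i` on the box, and (c) `b(q) = 0` for `q ≤ T`
  when `K ⊆ {T < ψ_i}` (the fibre `{ψ_i = q}` is empty; `ψ_i(realPoint n) = ψ_i(n)`);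
* (d) `∑_{q ≤ x, P⁻(q) > N^{1/u}, Ω(q) = m} b(q) = C_{(m,j')}` for `m ≥ 1` once `x` bounds the values:
  classify the points of the joint cell by the value `q = ψ_i(n)` (`Ω(q) = m ≥ 1` forces `q ≥ 2`, so
  `0 < q ≤ x`), the fibre at `q` being the fibre of the section weight (`Fin.insertNth` at `i` / at
  `i.succAbove k`);
* (e) passing from `K` to `K ∩ {T < ψ_i}` (`T ≥ 0`, `a_i ≠ 0`) loses at most `⌊T⌋ ≤ T + 1` points from a
  joint cell with `m ≥ 1` and from the fibre mass: the lost points have `0 < ψ_i(n) ≤ T` and `ψ_i` is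
  injective, so they inject into `[1, ⌊T⌋]`;
* (f) cells and section masses are monotone in the body.
-/

noncomputable section

open scoped BigOperators Classical
open Finset Literature.NumberTheory.Sieve

namespace Summit.Parity.GeneralizedHardyLittlewood.Cruxes.CellParityLaw.SectionAnnihilator

namespace SectionSeqBCellsAux

variable {t : ℕ} (Ψ : Fin (t + 1) → AffLinForm 1) (K : Set (Fin 1 → ℝ)) (N u : ℕ) (i : Fin (t + 1))
  (j' : Fin t → ℕ)

/-! ## One-dimensional affine-linear forms -/

/-- A non-zero coefficient vector on `Fin 1` has a non-zero `0`-th entry. -/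
theorem coeff_zero_ne_zero {ψ : AffLinForm 1} (h : ψ.coeff ≠ 0) : ψ.coeff 0 ≠ 0 := fun h0 =>
  h (funext fun j => by rw [Fin.fin_one_eq_zero j, h0, Pi.zero_apply])

/-- A form on `ℤ¹` with non-zero leading coefficient is injective (`ψ(n) = a n₀ + b`, `DimOne.eval_eq`). -/
theorem eval_injective {ψ : AffLinForm 1} (h : ψ.coeff ≠ 0) : Function.Injective ψ.eval := by
  intro n₁ n₂ he
  rw [DimOne.eval_eq, DimOne.eval_eq] at he
  have h0 : n₁ 0 = n₂ 0 := mul_left_cancel₀ (coeff_zero_ne_zero h) (add_right_cancel he)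
  funext j
  rw [Fin.fin_one_eq_zero j]
  exact h0

/-- The real extension of a form at the real point of a lattice point is its integer value. -/
theorem realEval_realPoint (ψ : AffLinForm 1) (n : Fin 1 → ℤ) :
    ψ.realEval (realPoint n) = (((ψ.eval n : ℤ)) : ℝ) :=
  AffLinForm.realEval_intCast ψ n

/-- In a rough `Ω`-cell of index `m ≥ 1` the value is `≥ 2`: `Ω(v) = m ≥ 1` forces `1 < v`. -/
theorem one_lt_toNat_of_cardFactors {v : ℤ} {m : ℕ} (hm : 1 ≤ m)
    (hv : ArithmeticFunction.cardFactors v.toNat = m) : 1 < v.toNat :=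
  ArithmeticFunction.cardFactors_pos_iff_one_lt.mp (by rw [hv]; exact hm)

/-! ## The weights of `secSeqB` -/

/-- The weights of `secSeqB` are the section weights `b(q)`. -/
theorem secSeqB_a (q : ℕ) : (secSeqB Ψ K N u i j').a q = (sectionWeight Ψ K N u i j' q : ℝ) := rfl

/-- **(a), over `ℕ`.** With `a_i ≠ 0` the fibre `{ψ_i = q}` contains at most one lattice point. -/
theorem sectionWeight_le_one (h : (Ψ i).coeff ≠ 0) (q : ℕ) : sectionWeight Ψ K N u i j' q ≤ 1 := by
  unfold sectionWeight
  rw [Finset.card_le_one]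
  intro a ha b hb
  rw [Finset.mem_filter] at ha hb
  exact eval_injective h (ha.2.2.1.trans hb.2.2.1.symm)

/-- The section weight at `q` vanishes if no lattice point of the box lying in `K` has `ψ_i(n) = q`. -/
theorem sectionWeight_eq_zero {q : ℕ}
    (h : ∀ n ∈ latticeBox 1 N, realPoint n ∈ K → (Ψ i).eval n ≠ (q : ℤ)) :
    sectionWeight Ψ K N u i j' q = 0 := by
  unfold sectionWeight
  rw [Finset.card_eq_zero, Finset.filter_eq_empty_iff]
  intro n hn hP
  exact h n hn hP.1 hP.2.1

/-- **(b), over `ℕ`.** The weights vanish above every bound `x` of the values of `ψ_i` on the box. -/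
theorem sectionWeight_eq_zero_of_lt {x : ℝ} {q : ℕ}
    (hx : ∀ n ∈ latticeBox 1 N, (((Ψ i).eval n : ℤ) : ℝ) ≤ x) (hq : x < (q : ℝ)) :
    sectionWeight Ψ K N u i j' q = 0 :=
  sectionWeight_eq_zero Ψ K N u i j' fun n hn _ hev => by
    have h1 := hx n hn
    rw [hev, Int.cast_natCast] at h1
    exact absurd (h1.trans_lt hq) (lt_irrefl _)

/-- **(c), over `ℕ`.** The weights vanish at or below `T` when `K ⊆ {T < ψ_i}`. -/
theorem sectionWeight_eq_zero_of_le {T : ℝ} {q : ℕ} (hK : K ⊆ {v | T < (Ψ i).realEval v})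
    (hq : (q : ℝ) ≤ T) : sectionWeight Ψ K N u i j' q = 0 :=
  sectionWeight_eq_zero Ψ K N u i j' fun n _ hnK hev => by
    have h1 : T < (Ψ i).realEval (realPoint n) := hK hnK
    rw [realEval_realPoint, hev, Int.cast_natCast] at h1
    exact absurd (h1.trans_le hq) (lt_irrefl _)

/-! ## (d) The rough cells of `secSeqB` are the joint cells -/

/-- **(d), over `ℕ`.** Once `x` bounds the values of `ψ_i` on the box, for `m ≥ 1`,
`∑_{0 < q ≤ x, P⁻(q) > N^{1/u}, Ω(q) = m} b(q) = C_{(m,j')}`: classify the points of the joint cell by the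
value `q = ψ_i(n)` (`≥ 2` since `Ω = m ≥ 1`); the fibre at `q` is the fibre of the section weight. -/
theorem sum_sectionWeight_eq_cell {x : ℝ} (hx : ∀ n ∈ latticeBox 1 N, (((Ψ i).eval n : ℤ) : ℝ) ≤ x)
    {m : ℕ} (hm : 1 ≤ m) :
    ∑ q ∈ (Finset.Ioc 0 ⌊x⌋₊).filter
        (fun q => (N : ℝ) ^ ((1 : ℝ) / u) < (Nat.minFac q : ℝ) ∧ ArithmeticFunction.cardFactors q = m),
      sectionWeight Ψ K N u i j' q = cell Ψ K N u (i.insertNth m j') := by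
  symm
  unfold cell
  rw [Finset.card_eq_sum_card_fiberwise (f := fun n => ((Ψ i).eval n).toNat)
    (t := (Finset.Ioc 0 ⌊x⌋₊).filter
      (fun q => (N : ℝ) ^ ((1 : ℝ) / u) < (Nat.minFac q : ℝ) ∧ ArithmeticFunction.cardFactors q = m))]
  · refine Finset.sum_congr rfl fun q hq => ?_
    rw [Finset.mem_filter] at hq
    unfold sectionWeight
    congr 1
    ext n
    simp only [Finset.mem_filter]
    constructor
    · rintro ⟨⟨hbox, hK, hall⟩, hfq⟩
      refine ⟨hbox, hK, ?_, fun k => ?_⟩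
      · have hi := hall i
        rw [Fin.insertNth_apply_same] at hi
        have h1 := one_lt_toNat_of_cardFactors hm hi.2
        omega
      · have hk := hall (i.succAbove k)
        rw [Fin.insertNth_apply_succAbove] at hk
        exact hk
    · rintro ⟨hbox, hK, hev, hfr⟩
      have htn : ((Ψ i).eval n).toNat = q := by rw [hev, Int.toNat_natCast]
      refine ⟨⟨hbox, hK, (Fin.forall_iff_succAbove i).mpr ⟨?_, fun k => ?_⟩⟩, htn⟩
      · rw [Fin.insertNth_apply_same, htn]
        exact hq.2
      · rw [Fin.insertNth_apply_succAbove]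
        exact hfr k
  · intro n hn
    rw [Finset.mem_coe, Finset.mem_filter] at hn
    obtain ⟨hbox, -, hall⟩ := hn
    have hi := hall i
    rw [Fin.insertNth_apply_same] at hi
    have h1 := one_lt_toNat_of_cardFactors hm hi.2
    have h2 : ((((Ψ i).eval n).toNat : ℕ) : ℤ) = (Ψ i).eval n := by omega
    have hxn := hx n hbox
    rw [← h2, Int.cast_natCast] at hxn
    show ((Ψ i).eval n).toNat ∈ (Finset.Ioc 0 ⌊x⌋₊).filter
      (fun q => (N : ℝ) ^ ((1 : ℝ) / u) < (Nat.minFac q : ℝ) ∧ ArithmeticFunction.cardFactors q = m)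
    rw [Finset.mem_filter, Finset.mem_Ioc]
    exact ⟨⟨by omega, Nat.le_floor hxn⟩, hi⟩

/-- **(d).** The kernel's rough cells of `secSeqB` at the threshold `N^{1/u}` are the joint cells
`C_{(m,j')}`, `m ≥ 1`, once `x` bounds the values of `ψ_i` on the box. -/
theorem roughCellSum_secSeqB_eq {x : ℝ} (hx : ∀ n ∈ latticeBox 1 N, (((Ψ i).eval n : ℤ) : ℝ) ≤ x)
    {m : ℕ} (hm : 1 ≤ m) :
    roughCellSum (secSeqB Ψ K N u i j') x ((N : ℝ) ^ ((1 : ℝ) / u)) m =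
      cell Ψ K N u (i.insertNth m j') := by
  unfold roughCellSum
  simp only [secSeqB_a]
  exact_mod_cast sum_sectionWeight_eq_cell Ψ K N u i j' hx hm

/-! ## (e) Localisation costs -/

/-- **Localisation count.** Let `ψ` be a form on `ℤ¹` with `a ≠ 0`, `T ≥ 0`, and `S, S'` finsets of
lattice points such that `ψ > 0` on `S` and every point of `S` with `ψ > T` lies in `S'`. Then
`#S ≤ #S' + (T + 1)`: the points of `S` outside `S'` have `0 < ψ(n) ≤ T`, and `ψ` is injective, so
`n ↦ ψ(n)` injects them into `[1, ⌊T⌋]`. -/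
theorem card_le_card_add {ψ : AffLinForm 1} (h : ψ.coeff ≠ 0) {T : ℝ} (hT : 0 ≤ T)
    (S S' : Finset (Fin 1 → ℤ)) (hpos : ∀ n ∈ S, 0 < ψ.eval n)
    (hsub : ∀ n ∈ S, T < ((ψ.eval n : ℤ) : ℝ) → n ∈ S') : (S.card : ℝ) ≤ S'.card + (T + 1) := by
  have h1 : (S \ S').card ≤ ⌊T⌋₊ := by
    calc (S \ S').card ≤ (Finset.Icc 1 ⌊T⌋₊).card :=
          Finset.card_le_card_of_injOn (fun n => (ψ.eval n).toNat) ?_ ?_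
      _ = ⌊T⌋₊ := by rw [Nat.card_Icc, Nat.add_sub_cancel]
    · intro n hn
      rw [Finset.mem_coe, Finset.mem_sdiff] at hn
      obtain ⟨hnS, hnS'⟩ := hn
      have hp := hpos n hnS
      have hle : ((ψ.eval n : ℤ) : ℝ) ≤ T := not_lt.mp fun hlt => hnS' (hsub n hnS hlt)
      have h3 : (((ψ.eval n).toNat : ℕ) : ℤ) = ψ.eval n := by omega
      rw [← h3, Int.cast_natCast] at hle
      simp only [Finset.coe_Icc, Set.mem_Icc]
      exact ⟨by omega, Nat.le_floor hle⟩
    · intro a ha b hb hab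
      rw [Finset.mem_coe, Finset.mem_sdiff] at ha hb
      have hpa := hpos a ha.1
      have hpb := hpos b hb.1
      have hab' : (ψ.eval a).toNat = (ψ.eval b).toNat := hab
      exact eval_injective h (by omega)
  have h2 : S.card ≤ S'.card + ⌊T⌋₊ :=
    (Finset.card_le_card_sdiff_add_card (s := S) (t := S')).trans (by omega)
  have h3 : (S.card : ℝ) ≤ S'.card + ⌊T⌋₊ := by exact_mod_cast h2
  have h4 : ((⌊T⌋₊ : ℕ) : ℝ) ≤ T := Nat.floor_le hT
  linarith

/-- **(e), cells.** For `T ≥ 0`, `a_i ≠ 0` and `m ≥ 1`, `C_{(m,j')}(K) ≤ C_{(m,j')}(K ∩ {T < ψ_i}) + (T + 1)`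
(a point of the cell has `ψ_i(n) ≥ 2 > 0`). -/
theorem cell_le_cell_inter_add {T : ℝ} (hT : 0 ≤ T) (h : (Ψ i).coeff ≠ 0) {m : ℕ} (hm : 1 ≤ m) :
    (cell Ψ K N u (i.insertNth m j') : ℝ) ≤
      cell Ψ (K ∩ {v | T < (Ψ i).realEval v}) N u (i.insertNth m j') + (T + 1) := by
  unfold cell
  refine card_le_card_add h hT _ _ (fun n hn => ?_) (fun n hn hlt => ?_)
  · rw [Finset.mem_filter] at hn
    have hi := hn.2.2 i
    rw [Fin.insertNth_apply_same] at hi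
    have h1 := one_lt_toNat_of_cardFactors hm hi.2
    omega
  · simp only [Finset.mem_filter] at hn ⊢
    obtain ⟨hbox, hK, hall⟩ := hn
    refine ⟨hbox, ⟨hK, ?_⟩, hall⟩
    rw [Set.mem_setOf_eq, realEval_realPoint]
    exact hlt

/-- **(e), fibre mass.** For `T ≥ 0` and `a_i ≠ 0`, `F⁽ⁱ⁾_{j'}(K) ≤ F⁽ⁱ⁾_{j'}(K ∩ {T < ψ_i}) + (T + 1)`
(positivity of `ψ_i` is built into the section mass). -/
theorem sectionMass_le_sectionMass_inter_add {T : ℝ} (hT : 0 ≤ T) (h : (Ψ i).coeff ≠ 0) :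
    (sectionMass Ψ K N u i j' 1 : ℝ) ≤
      sectionMass Ψ (K ∩ {v | T < (Ψ i).realEval v}) N u i j' 1 + (T + 1) := by
  unfold sectionMass
  refine card_le_card_add h hT _ _ (fun n hn => ?_) (fun n hn hlt => ?_)
  · rw [Finset.mem_filter] at hn
    exact hn.2.2.1
  · simp only [Finset.mem_filter] at hn ⊢
    obtain ⟨hbox, hK, hrest⟩ := hn
    refine ⟨hbox, ⟨hK, ?_⟩, hrest⟩
    rw [Set.mem_setOf_eq, realEval_realPoint]
    exact hlt

/-! ## (f) Monotonicity in the body -/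

/-- **(f), cells.** Joint cells are monotone in the body. -/
theorem cell_mono {K' : Set (Fin 1 → ℝ)} (hK' : K' ⊆ K) (j : Fin (t + 1) → ℕ) :
    cell Ψ K' N u j ≤ cell Ψ K N u j := by
  unfold cell
  refine Finset.card_le_card fun n hn => ?_
  rw [Finset.mem_filter] at hn ⊢
  exact ⟨hn.1, hK' hn.2.1, hn.2.2⟩

/-- **(f), section masses.** Section masses are monotone in the body. -/
theorem sectionMass_mono {K' : Set (Fin 1 → ℝ)} (hK' : K' ⊆ K) (d : ℕ) :
    sectionMass Ψ K' N u i j' d ≤ sectionMass Ψ K N u i j' d := by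
  unfold sectionMass
  refine Finset.card_le_card fun n hn => ?_
  rw [Finset.mem_filter] at hn ⊢
  exact ⟨hn.1, hK' hn.2.1, hn.2.2⟩

end SectionSeqBCellsAux

open SectionSeqBCellsAux in
/-- **`stub_sectionSeqBCells`** (registered stub of skeleton v13, line `section-annihilator`): the
weight-side identities of `secSeqB` — (a) weights `≤ 1` for `a_i ≠ 0`; (b) they vanish above every bound
of the values of `ψ_i` on the box and (c) at or below `T` when `K ⊆ {T < ψ_i}`; (d) the kernel's rough cells
of `secSeqB` at threshold `N^{1/u}` are the joint cells `C_{(m,j')}`, `m ≥ 1`; (e) localisation to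
`K ∩ {T < ψ_i}` costs at most `T + 1` on cells and fibre mass; (f) both are monotone in the body. -/
theorem stub_sectionSeqBCells : SectionSeqBCells := by
  intro t Ψ K N u i j'
  refine ⟨fun h q => ?_, fun x q hx hq => ?_, fun T q hK hq => ?_, fun x hx m hm => ?_,
    fun T hT h m hm => ⟨?_, ?_⟩, fun K' hK' => ⟨fun j => ?_, fun d => ?_⟩⟩
  · rw [secSeqB_a]
    exact_mod_cast sectionWeight_le_one Ψ K N u i j' h q
  · rw [secSeqB_a, sectionWeight_eq_zero_of_lt Ψ K N u i j' hx hq, Nat.cast_zero]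
  · rw [secSeqB_a, sectionWeight_eq_zero_of_le Ψ K N u i j' hK hq, Nat.cast_zero]
  · exact roughCellSum_secSeqB_eq Ψ K N u i j' hx hm
  · exact cell_le_cell_inter_add Ψ K N u i j' hT h hm
  · exact sectionMass_le_sectionMass_inter_add Ψ K N u i j' hT h
  · exact cell_mono Ψ K N u hK' j
  · exact sectionMass_mono Ψ K N u i j' hK' d

end Summit.Parity.GeneralizedHardyLittlewood.Cruxes.CellParityLaw.SectionAnnihilator

end
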